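import Literature.Analysis.FluidPDE.Tao2016AveragedNS.SplitCascadeRescaledModes
import Literature.Analysis.FluidPDE.TaoCascadeRescaledBootstrap
import Literature.Analysis.ODE.MaximalTime
import HarnessLib

/-!
# The split Prop. 6.5: Lemma 6.7 (past energies), Lemma 6.8 (initial bounds) and the bootstrap time `T₁` (layer 2 of the §6.5–6.7 port)

T. Tao, *Finite time blowup for an averaged three-dimensional Navier–Stokes equation*,
J. Amer. Math. Soc. 29 (2016), 601–674 (arXiv:1402.0290v3), §6.4 Lemma 6.7, §6.5 Lemma 6.8 and
the definition of `T₁` (p. 35). HONEST FRAMING: statements about the SPLIT cascade model system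
(rescaled hypotheses `RescaledSplitHypotheses`, `SplitCascadeRescaled.lean`); nothing here proves
the split Prop. 6.5 and nothing here concerns the true Navier–Stokes equations.

This file is the split counterpart of `TaoCascadeRescaledEnergy.lean` (the part after the basic
API, which is `SplitCascadeRescaledModes.lean`) and `TaoCascadeRescaledBootstrap.lean`: the SAME
lemmas with the SAME names under `RescaledSplitHypotheses`, so that the downstream bootstrap files
port by renaming. All of Lemma 6.7 and (6.80), (6.82), (6.83) of Lemma 6.8 concern energies only
and port VERBATIM (the energy clauses (6.64)–(6.66), (6.50), (6.52), (6.53) of the split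
hypotheses are Tao's, byte-identical). The one place where the asymmetry enters is (6.81)
`Ẽ₀(0) + Ẽ₁(0) ≤ 0.6`: the energy defect (6.51♯) at the checkpoint reads
`Ẽ₀ ≤ ½Σã² + ½ΣZ̃² + C₂(1+ε₀)^{-n₀/2}∫Ẽ₀`, and the asymmetry of the active shell at the checkpoint
is bounded by the profile clause `|Z̃_{i,0}(0)| ≤ η(0)` — so `energy_zero_during` and `goodAt_zero`
take the extra hypothesis `η(0) ≤ 10⁻³` (any `n₀`-small profile satisfies it). The bootstrap
regime `GoodAt`, the time `T1` and the `h`-free lemmas (`le_of_Ico_of_continuousOn`, `T1_mem`,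
`le_T1_of_goodAt`, `T1_exit`, `geomConst`, `cumEnergyConst`) are Tao's own (`TaoCascade.*`), reused,
not restated. Also recorded: the aliases `continuousOn_X/E`, `hasDeriv_X/E`, `tau_ge'`,
`en_before'/during'/after'` under the tree's names.

## References

* T. Tao, J. Amer. Math. Soc. 29 (2016), 601–674, §6.4 Lemma 6.7, §6.5 Lemma 6.8 and the
  definition of `T₁` (p. 35). [`Tao2016AveragedNS`]
-/

noncomputable section

open Set MeasureTheory intervalIntegral Filter Topology
open Literature.Analysis.ODE

namespace Literature.Analysis.FluidPDE

namespace Tao2016AveragedNS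

open TaoCascade

section Basic

variable {γ ε₀ K ε C₁ C₂ C₃ : ℝ} {n₀ N : ℤ} {ηp : ℤ → ℝ} {βp : ℕ → ℝ} {τ : ℤ → ℝ}
  {Xr : Fin 4 → ℤ → ℝ → ℝ} {W : Fin 3 → ℤ → ℝ → ℝ} {Er : ℤ → ℝ → ℝ}

/-! ## Aliases under the tree's names -/

/-- (vii), lower bound, with the exponent written `-(251/100) k` for `k ≤ 0`.
[cite: Tao2016AveragedNS, §6.4 Prop. 6.5 (vii)] -/
theorem RescaledSplitHypotheses.tau_ge'
    (h : RescaledSplitHypotheses γ ε₀ K ε C₁ C₂ C₃ n₀ N ηp βp τ Xr W Er) (k : ℤ)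
    (hk1 : n₀ - N ≤ k) (hk2 : k ≤ 0) : -(C₃ * (1 + ε₀) ^ (-(251 : ℝ) / 100 * k)) ≤ τ k := by
  have := h.tau_ge k hk1 hk2
  have hk : |(k : ℝ)| = -(k : ℝ) := abs_of_nonpos (by exact_mod_cast hk2)
  rw [hk] at this
  convert this using 4
  ring

/-- (ix), first display, with `|k-1|/50` written `(1-k)/50` (`k ≤ 0`) and the time quantified
before `m`. [cite: Tao2016AveragedNS, §6.4 Prop. 6.5 (ix)] -/
theorem RescaledSplitHypotheses.en_before'
    (h : RescaledSplitHypotheses γ ε₀ K ε C₁ C₂ C₃ n₀ N ηp βp τ Xr W Er)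
    (k : ℤ) (hk : n₀ - N < k) (hk0 : k ≤ 0) (t : ℝ) (ht : t ∈ Icc (τ (k - 1)) (τ k)) (m : ℕ)
    (hm : 2 ≤ m) : Er (k - m) t ≤ (K ^ 10)⁻¹ * (1 + ε₀) ^ ((m : ℝ) / 10 + (1 - k) / 50) := by
  have := h.en_before k hk hk0 m hm t ht
  have hkR : (k : ℝ) ≤ 0 := by exact_mod_cast hk0
  have hk' : |(k : ℝ) - 1| = 1 - (k : ℝ) := by
    rw [abs_of_nonpos (by linarith)]; ring
  rwa [hk'] at this

/-- (ix), second display, with `|k-1|/50` written `(1-k)/50`. [cite: Tao2016AveragedNS, §6.4 Prop. 6.5 (ix)] -/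
theorem RescaledSplitHypotheses.en_during'
    (h : RescaledSplitHypotheses γ ε₀ K ε C₁ C₂ C₃ n₀ N ηp βp τ Xr W Er)
    (k : ℤ) (hk : n₀ - N < k) (hk0 : k ≤ 0) (t : ℝ) (ht : t ∈ Icc (τ (k - 1)) (τ k)) :
    Er (k - 1) t + Er k t ≤ (1 + ε₀) ^ ((1 - (k : ℝ)) / 50) := by
  have := h.en_during k hk hk0 t ht
  have hkR : (k : ℝ) ≤ 0 := by exact_mod_cast hk0
  have hk' : |(k : ℝ) - 1| = 1 - (k : ℝ) := by
    rw [abs_of_nonpos (by linarith)]; ring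
  rwa [hk'] at this

/-- (ix), third display, with `|k-1|/50` written `(1-k)/50` and the time quantified before `m`.
[cite: Tao2016AveragedNS, §6.4 Prop. 6.5 (ix)] -/
theorem RescaledSplitHypotheses.en_after'
    (h : RescaledSplitHypotheses γ ε₀ K ε C₁ C₂ C₃ n₀ N ηp βp τ Xr W Er)
    (k : ℤ) (hk : n₀ - N < k) (hk0 : k ≤ 0) (t : ℝ) (ht : t ∈ Icc (τ (k - 1)) (τ k)) (m : ℕ)
    (hm : 1 ≤ m) : Er (k + m) t ≤ (K ^ 30)⁻¹ * (1 + ε₀) ^ (-(10 : ℝ) * m + (1 - k) / 50) := by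
  have := h.en_after k hk hk0 m hm t ht
  have hkR : (k : ℝ) ≤ 0 := by exact_mod_cast hk0
  have hk' : |(k : ℝ) - 1| = 1 - (k : ℝ) := by
    rw [abs_of_nonpos (by linarith)]; ring
  rwa [hk'] at this

/-- Continuity of the symmetric amplitudes (the tree's name). [cite: Tao2016AveragedNS, §6.4 Prop. 6.5] -/
theorem RescaledSplitHypotheses.continuousOn_X
    (h : RescaledSplitHypotheses γ ε₀ K ε C₁ C₂ C₃ n₀ N ηp βp τ Xr W Er) (i : Fin 4) (k : ℤ)
    {a b : ℝ} (ha : τ (n₀ - N) ≤ a) : ContinuousOn (Xr i k) (Icc a b) :=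
  h.continuousOn_Y i k ha

/-- Continuity of the energies (the tree's name). [cite: Tao2016AveragedNS, §6.4 Prop. 6.5] -/
theorem RescaledSplitHypotheses.continuousOn_E
    (h : RescaledSplitHypotheses γ ε₀ K ε C₁ C₂ C₃ n₀ N ηp βp τ Xr W Er) (k : ℤ) {a b : ℝ}
    (ha : τ (n₀ - N) ≤ a) : ContinuousOn (Er k) (Icc a b) :=
  h.continuousOn_F k ha

/-- One-sided derivatives of the symmetric amplitudes (the tree's name).
[cite: Tao2016AveragedNS, §6.4 Prop. 6.5] -/
theorem RescaledSplitHypotheses.hasDeriv_X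
    (h : RescaledSplitHypotheses γ ε₀ K ε C₁ C₂ C₃ n₀ N ηp βp τ Xr W Er) (i : Fin 4) (k : ℤ)
    {t : ℝ} (ht : τ (n₀ - N) ≤ t) :
    HasDerivWithinAt (Xr i k) (derivWithin (Xr i k) (Ici (τ (n₀ - N))) t) (Ici t) t :=
  h.hasDeriv_Y i k ht

/-- One-sided derivatives of the energies (the tree's name). [cite: Tao2016AveragedNS, §6.4 Prop. 6.5] -/
theorem RescaledSplitHypotheses.hasDeriv_E
    (h : RescaledSplitHypotheses γ ε₀ K ε C₁ C₂ C₃ n₀ N ηp βp τ Xr W Er) (k : ℤ) {t : ℝ}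
    (ht : τ (n₀ - N) ≤ t) :
    HasDerivWithinAt (Er k) (derivWithin (Er k) (Ici (τ (n₀ - N))) t) (Ici t) t :=
  h.hasDeriv_F k ht


/-! ## Lemma 6.7: energies in the past and the cumulative energy bound -/

/-- **Scale-by-scale bound of the past energies** (the display in the proof of Lemma 6.7:
"`Ẽ_m(t) ≲ (1+ε₀)^{10k+|k|/50}` whenever `τ_{k-1} ≤ t ≤ τ_k`"), made explicit for
`m ∈ {-1, 0, 1}` and `K ≥ 1`: `Ẽ_m(t) ≤ 2^{11} (1+ε₀)^{(499/50) k}`.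
[cite: Tao2016AveragedNS, §6.4 Lemma 6.7] -/
theorem RescaledSplitHypotheses.energy_past_le
    (h : RescaledSplitHypotheses γ ε₀ K ε C₁ C₂ C₃ n₀ N ηp βp τ Xr W Er) (hε₀ : 0 < ε₀) (hε₀1 : ε₀ < 1)
    (hK : 1 ≤ K) {m : ℤ} (hm : m = -1 ∨ m = 0 ∨ m = 1) {k : ℤ} (hk : n₀ - N < k) (hk0 : k ≤ 0)
    {t : ℝ} (ht : t ∈ Icc (τ (k - 1)) (τ k)) :
    Er m t ≤ 2 ^ 11 * (1 + ε₀) ^ ((499 : ℝ) / 50 * k) := by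
  have h0 : (0 : ℝ) < 1 + ε₀ := by linarith
  have h1 : (1 : ℝ) ≤ 1 + ε₀ := by linarith
  have hq2 : (1 + ε₀ : ℝ) ≤ 2 := by linarith
  have hτt : τ (n₀ - N) ≤ t := (h.tau_init_le_tau (by omega) (by omega)).trans ht.1
  have hK10 : (K ^ 10)⁻¹ ≤ 1 := inv_le_one_of_one_le₀ (one_le_pow₀ hK)
  have hK30 : (K ^ 30)⁻¹ ≤ 1 := inv_le_one_of_one_le₀ (one_le_pow₀ hK)
  have hP : 0 < (1 + ε₀) ^ ((499 : ℝ) / 50 * k) := Real.rpow_pos_of_pos h0 _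
  -- small rpow facts
  have hsmall : ∀ x : ℝ, 0 ≤ x → x ≤ 11 → (1 + ε₀) ^ x ≤ 2 ^ 11 := by
    intro x hx hx11
    calc (1 + ε₀) ^ x ≤ (2 : ℝ) ^ x := Real.rpow_le_rpow h0.le hq2 hx
      _ ≤ (2 : ℝ) ^ (11 : ℝ) := Real.rpow_le_rpow_of_exponent_le (by norm_num) hx11
      _ = 2 ^ 11 := by norm_num
  rcases hm with rfl | rfl | rfl
  · -- m = -1
    rcases lt_trichotomy k (-1) with hk' | rfl | hk'
    · -- k ≤ -2: after-bound with m' = -1-k ≥ 1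
      obtain ⟨m', hm'⟩ : ∃ m' : ℕ, (m' : ℤ) = -1 - k := ⟨(-1 - k).toNat, by omega⟩
      have hb := h.en_after' k hk hk0 t ht m' (by omega)
      rw [show k + (m' : ℤ) = -1 by omega] at hb
      have hexp : -(10 : ℝ) * m' + (1 - k) / 50 = (501 : ℝ) / 50 + (499 : ℝ) / 50 * k := by
        have : (m' : ℝ) = -1 - (k : ℝ) := by exact_mod_cast hm'
        rw [this]; ring
      rw [hexp, Real.rpow_add h0] at hb
      calc Er (-1) t ≤ (K ^ 30)⁻¹ * ((1 + ε₀) ^ ((501 : ℝ) / 50) * (1 + ε₀) ^ ((499 : ℝ) / 50 * k)) := hb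
        _ ≤ 1 * (2 ^ 11 * (1 + ε₀) ^ ((499 : ℝ) / 50 * k)) := by
            apply mul_le_mul hK30 _ (by positivity) zero_le_one
            exact mul_le_mul_of_nonneg_right (hsmall _ (by norm_num) (by norm_num)) hP.le
        _ = _ := by ring
    · -- k = -1: during-bound at k = -1
      have hb := h.en_during' (-1) hk hk0 t ht
      have hnn : 0 ≤ Er (-1 - 1) t := h.nonneg_F _ _ hτt
      have hE : Er (-1) t ≤ (1 + ε₀) ^ ((1 - ((-1 : ℤ) : ℝ)) / 50) :=
        (le_add_of_nonneg_left hnn).trans hb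
      have hinv : (1 + ε₀) ^ ((499 : ℝ) / 50 * ((-1 : ℤ) : ℝ)) =
          ((1 + ε₀) ^ ((499 : ℝ) / 50))⁻¹ := by
        rw [← Real.rpow_neg h0.le]; congr 1; push_cast; ring
      rw [hinv, ← div_eq_mul_inv, le_div_iff₀ (Real.rpow_pos_of_pos h0 _)]
      calc Er (-1) t * (1 + ε₀) ^ ((499 : ℝ) / 50)
          ≤ (1 + ε₀) ^ ((1 - ((-1 : ℤ) : ℝ)) / 50) * (1 + ε₀) ^ ((499 : ℝ) / 50) :=
            mul_le_mul_of_nonneg_right hE (Real.rpow_pos_of_pos h0 _).le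
        _ = (1 + ε₀) ^ ((1 - ((-1 : ℤ) : ℝ)) / 50 + (499 : ℝ) / 50) := (Real.rpow_add h0 _ _).symm
        _ ≤ 2 ^ 11 := hsmall _ (by norm_num) (by norm_num)
    · -- k = 0
      obtain rfl : k = 0 := by omega
      have hb := h.en_during' 0 hk hk0 t ht
      have hnn : 0 ≤ Er 0 t := h.nonneg_F _ _ hτt
      have h01 : Er (-1) t = Er (0 - 1) t := by norm_num
      calc Er (-1) t = Er (0 - 1) t := h01
        _ ≤ Er (0 - 1) t + Er 0 t := le_add_of_nonneg_right hnn
        _ ≤ (1 + ε₀) ^ ((1 - ((0 : ℤ) : ℝ)) / 50) := hb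
        _ ≤ 2 ^ 11 := hsmall _ (by norm_num) (by norm_num)
        _ = 2 ^ 11 * (1 + ε₀) ^ ((499 : ℝ) / 50 * ((0 : ℤ) : ℝ)) := by simp
  · -- m = 0
    rcases lt_or_eq_of_le hk0 with hk' | rfl
    · obtain ⟨m', hm'⟩ : ∃ m' : ℕ, (m' : ℤ) = -k := ⟨(-k).toNat, by omega⟩
      have hb := h.en_after' k hk hk0 t ht m' (by omega)
      rw [show k + (m' : ℤ) = 0 by omega] at hb
      have hexp : -(10 : ℝ) * m' + (1 - k) / 50 = (1 : ℝ) / 50 + (499 : ℝ) / 50 * k := by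
        have : (m' : ℝ) = -(k : ℝ) := by exact_mod_cast hm'
        rw [this]; ring
      rw [hexp, Real.rpow_add h0] at hb
      calc Er 0 t ≤ (K ^ 30)⁻¹ * ((1 + ε₀) ^ ((1 : ℝ) / 50) * (1 + ε₀) ^ ((499 : ℝ) / 50 * k)) := hb
        _ ≤ 1 * (2 ^ 11 * (1 + ε₀) ^ ((499 : ℝ) / 50 * k)) := by
            apply mul_le_mul hK30 _ (by positivity) zero_le_one
            exact mul_le_mul_of_nonneg_right (hsmall _ (by norm_num) (by norm_num)) hP.le
        _ = _ := by ring
    · have hb := h.en_during' 0 hk hk0 t ht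
      have hnn : 0 ≤ Er (0 - 1) t := h.nonneg_F _ _ hτt
      calc Er 0 t ≤ Er (0 - 1) t + Er 0 t := le_add_of_nonneg_left hnn
        _ ≤ (1 + ε₀) ^ ((1 - ((0 : ℤ) : ℝ)) / 50) := hb
        _ ≤ 2 ^ 11 := hsmall _ (by norm_num) (by norm_num)
        _ = 2 ^ 11 * (1 + ε₀) ^ ((499 : ℝ) / 50 * ((0 : ℤ) : ℝ)) := by simp
  · -- m = 1: after-bound with m' = 1 - k ≥ 1
    obtain ⟨m', hm'⟩ : ∃ m' : ℕ, (m' : ℤ) = 1 - k := ⟨(1 - k).toNat, by omega⟩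
    have hb := h.en_after' k hk hk0 t ht m' (by omega)
    rw [show k + (m' : ℤ) = 1 by omega] at hb
    have hexp : -(10 : ℝ) * m' + (1 - k) / 50 = -(499 : ℝ) / 50 + (499 : ℝ) / 50 * k := by
      have : (m' : ℝ) = 1 - (k : ℝ) := by exact_mod_cast hm'
      rw [this]; ring
    rw [hexp, Real.rpow_add h0] at hb
    have hneg : (1 + ε₀) ^ (-(499 : ℝ) / 50) ≤ 1 :=
      Real.rpow_le_one_of_one_le_of_nonpos h1 (by norm_num)
    calc Er 1 t ≤ (K ^ 30)⁻¹ * ((1 + ε₀) ^ (-(499 : ℝ) / 50) * (1 + ε₀) ^ ((499 : ℝ) / 50 * k)) := hb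
      _ ≤ 1 * (2 ^ 11 * (1 + ε₀) ^ ((499 : ℝ) / 50 * k)) := by
          apply mul_le_mul hK30 _ (by positivity) zero_le_one
          exact mul_le_mul_of_nonneg_right (hneg.trans (by norm_num)) hP.le
      _ = _ := by ring

/-- The refined past bound for `Ẽ_1` keeping the factor `K^{-30}`:
`Ẽ_1(t) ≤ K^{-30} (1+ε₀)^{(499/50) k}` on `[τ_{k-1}, τ_k]` (proof of Prop. 6.13, display (6.95):
"`Ẽ_1(t) ≲ K^{-30} (1+ε₀)^{10k}`"). [cite: Tao2016AveragedNS, §6.6 Prop. 6.13] -/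
theorem RescaledSplitHypotheses.energy_one_past_le
    (h : RescaledSplitHypotheses γ ε₀ K ε C₁ C₂ C₃ n₀ N ηp βp τ Xr W Er) (hε₀ : 0 < ε₀)
    {k : ℤ} (hk : n₀ - N < k) (hk0 : k ≤ 0) {t : ℝ} (ht : t ∈ Icc (τ (k - 1)) (τ k)) :
    Er 1 t ≤ (K ^ 30)⁻¹ * (1 + ε₀) ^ ((499 : ℝ) / 50 * k) := by
  have h0 : (0 : ℝ) < 1 + ε₀ := by linarith
  have h1 : (1 : ℝ) ≤ 1 + ε₀ := by linarith
  obtain ⟨m', hm'⟩ : ∃ m' : ℕ, (m' : ℤ) = 1 - k := ⟨(1 - k).toNat, by omega⟩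
  have hb := h.en_after' k hk hk0 t ht m' (by omega)
  rw [show k + (m' : ℤ) = 1 by omega] at hb
  have hexp : -(10 : ℝ) * m' + (1 - k) / 50 = -(499 : ℝ) / 50 + (499 : ℝ) / 50 * k := by
    have : (m' : ℝ) = 1 - (k : ℝ) := by exact_mod_cast hm'
    rw [this]; ring
  rw [hexp, Real.rpow_add h0] at hb
  have hneg : (1 + ε₀) ^ (-(499 : ℝ) / 50) ≤ 1 :=
    Real.rpow_le_one_of_one_le_of_nonpos h1 (by norm_num)
  have hP : 0 < (1 + ε₀) ^ ((499 : ℝ) / 50 * k) := Real.rpow_pos_of_pos h0 _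
  calc Er 1 t ≤ (K ^ 30)⁻¹ * ((1 + ε₀) ^ (-(499 : ℝ) / 50) * (1 + ε₀) ^ ((499 : ℝ) / 50 * k)) := hb
    _ ≤ (K ^ 30)⁻¹ * (1 * (1 + ε₀) ^ ((499 : ℝ) / 50 * k)) := by
        apply mul_le_mul_of_nonneg_left _ (by positivity)
        exact mul_le_mul_of_nonneg_right hneg hP.le
    _ = _ := by ring

/-- **Summing over the past scales** (the mechanism of Lemma 6.7: "Applying (6.51) and summing
the geometric series"): if a function `F`, continuous on `[τ_{n₀-N}, 0]`, obeys
`F ≤ D (1+ε₀)^{(s + 251/100) k}` on each `[τ_{k-1}, τ_k]` (`n₀-N < k ≤ 0`), then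
`∫_{τ_{n₀-N}}^{τ_k} F ≤ D C₃ geomConst ε₀ s (1+ε₀)^{s k}` for `n₀-N ≤ k ≤ 0`.
[cite: Tao2016AveragedNS, §6.4 Lemma 6.7] -/
theorem RescaledSplitHypotheses.integral_past_le
    (h : RescaledSplitHypotheses γ ε₀ K ε C₁ C₂ C₃ n₀ N ηp βp τ Xr W Er) (hε₀ : 0 < ε₀) (hC₃ : 0 ≤ C₃)
    {F : ℝ → ℝ} (hF : ContinuousOn F (Icc (τ (n₀ - N)) 0)) {D s : ℝ} (hD : 0 ≤ D) (hs : 0 < s)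
    (hbound : ∀ k, n₀ - N < k → k ≤ 0 → ∀ t ∈ Icc (τ (k - 1)) (τ k),
      F t ≤ D * (1 + ε₀) ^ ((s + (251 : ℝ) / 100) * k))
    {k : ℤ} (hk1 : n₀ - N ≤ k) (hk2 : k ≤ 0) :
    ∫ t in (τ (n₀ - N))..(τ k), F t ≤ D * C₃ * geomConst ε₀ s * (1 + ε₀) ^ (s * k) := by
  have h0 : (0 : ℝ) < 1 + ε₀ := by linarith
  have h1 : (1 : ℝ) < 1 + ε₀ := by linarith
  have hρ : (1 + ε₀) ^ (-s) < 1 := Real.rpow_lt_one_of_one_lt_of_neg h1 (by linarith)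
  have hρ0 : 0 < (1 + ε₀) ^ (-s) := Real.rpow_pos_of_pos h0 _
  have hG : 0 < geomConst ε₀ s := geomConst_pos hε₀ hs
  -- integrability on sub-intervals of `[τ₀, 0]`
  have hint : ∀ {x y : ℝ}, τ (n₀ - N) ≤ x → x ≤ y → y ≤ 0 → IntervalIntegrable F volume x y :=
    fun hx hxy hy => (hF.mono (Icc_subset_Icc hx hy)).intervalIntegrable_of_Icc hxy
  induction k, hk1 using Int.leInduction with
  | base =>
    rw [integral_same]
    positivity
  | succ k hk ih =>
    have ih' := ih (by omega)
    have hτk : τ (n₀ - N) ≤ τ k := h.tau_init_le_tau hk (by omega)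
    have hkk : τ k ≤ τ (k + 1) := by
      have := h.tau_lt (k + 1) (by omega) hk2
      simp only [add_sub_cancel_right] at this
      exact this.le
    have hk10 : τ (k + 1) ≤ 0 := h.tau_le (k + 1) (by omega) hk2
    rw [← integral_add_adjacent_intervals (hint le_rfl hτk (hkk.trans hk10))
      (hint hτk hkk hk10)]
    -- the new piece
    have hpiece : ∫ t in (τ k)..(τ (k + 1)), F t ≤
        D * (1 + ε₀) ^ ((s + (251 : ℝ) / 100) * ((k + 1 : ℤ) : ℝ)) * (τ (k + 1) - τ k) := by
      have hb := hbound (k + 1) (by omega) hk2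
      simp only [add_sub_cancel_right] at hb
      have := integral_mono_on hkk (hint hτk hkk hk10) (g := fun _ =>
        D * (1 + ε₀) ^ ((s + (251 : ℝ) / 100) * ((k + 1 : ℤ) : ℝ))) intervalIntegrable_const
        (fun t ht => hb t ht)
      rwa [intervalIntegral.integral_const, smul_eq_mul, mul_comm] at this
    -- length of the new piece: `τ_{k+1} - τ_k ≤ -τ_k ≤ C₃ q^{-(251/100) k}`
    have hlen : τ (k + 1) - τ k ≤ C₃ * (1 + ε₀) ^ (-(251 : ℝ) / 100 * k) := by
      have := h.tau_ge' k hk (by omega)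
      linarith
    have hstep : D * (1 + ε₀) ^ ((s + (251 : ℝ) / 100) * ((k + 1 : ℤ) : ℝ)) * (τ (k + 1) - τ k) ≤
        D * C₃ * (1 + ε₀) ^ ((251 : ℝ) / 100) * (1 + ε₀) ^ (s * ((k + 1 : ℤ) : ℝ)) := by
      calc D * (1 + ε₀) ^ ((s + (251 : ℝ) / 100) * ((k + 1 : ℤ) : ℝ)) * (τ (k + 1) - τ k)
          ≤ D * (1 + ε₀) ^ ((s + (251 : ℝ) / 100) * ((k + 1 : ℤ) : ℝ)) *
              (C₃ * (1 + ε₀) ^ (-(251 : ℝ) / 100 * k)) :=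
            mul_le_mul_of_nonneg_left hlen (by positivity)
        _ = D * C₃ * ((1 + ε₀) ^ ((s + (251 : ℝ) / 100) * ((k + 1 : ℤ) : ℝ)) *
              (1 + ε₀) ^ (-(251 : ℝ) / 100 * k)) := by ring
        _ = D * C₃ * (1 + ε₀) ^ ((251 : ℝ) / 100) * (1 + ε₀) ^ (s * ((k + 1 : ℤ) : ℝ)) := by
            rw [← Real.rpow_add h0, mul_assoc (D * C₃), ← Real.rpow_add h0]
            congr 2; push_cast; ring
    -- combine with the induction hypothesis using `ρ + (1 - ρ) = 1`
    have hρk : (1 + ε₀) ^ (s * (k : ℝ)) = (1 + ε₀) ^ (-s) * (1 + ε₀) ^ (s * ((k + 1 : ℤ) : ℝ)) := by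
      rw [← Real.rpow_add h0]; congr 1; push_cast; ring
    rw [hρk] at ih'
    have hP : 0 < (1 + ε₀) ^ (s * ((k + 1 : ℤ) : ℝ)) := Real.rpow_pos_of_pos h0 _
    have hkey : D * C₃ * geomConst ε₀ s * ((1 + ε₀) ^ (-s) * (1 + ε₀) ^ (s * ((k + 1 : ℤ) : ℝ))) +
        D * C₃ * (1 + ε₀) ^ ((251 : ℝ) / 100) * (1 + ε₀) ^ (s * ((k + 1 : ℤ) : ℝ)) =
        D * C₃ * geomConst ε₀ s * (1 + ε₀) ^ (s * ((k + 1 : ℤ) : ℝ)) := by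
      have hne : 1 - (1 + ε₀) ^ (-s) ≠ 0 := by linarith
      unfold geomConst
      field_simp
      ring
    linarith [hpiece, hstep, ih', hkey]

/-- **Lemma 6.7 (cumulative energy bound)**, explicit: for `m ∈ {-1, 0, 1}` and `K ≥ 1`,
`∫_{τ_{n₀-N}}^{τ_k} Ẽ_m ≤ cumEnergyConst ε₀ C₃ · (1+ε₀)^{(747/100) k}` for `n₀-N ≤ k ≤ 0`; in
particular (`k = 0`) `∫_{τ_{n₀-N}}^0 Ẽ_m ≤ cumEnergyConst ε₀ C₃`.
[cite: Tao2016AveragedNS, §6.4 Lemma 6.7] -/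
theorem RescaledSplitHypotheses.integral_energy_past_le
    (h : RescaledSplitHypotheses γ ε₀ K ε C₁ C₂ C₃ n₀ N ηp βp τ Xr W Er) (hε₀ : 0 < ε₀) (hε₀1 : ε₀ < 1)
    (hK : 1 ≤ K) (hC₃ : 0 ≤ C₃) {m : ℤ} (hm : m = -1 ∨ m = 0 ∨ m = 1) {k : ℤ} (hk1 : n₀ - N ≤ k)
    (hk2 : k ≤ 0) :
    ∫ t in (τ (n₀ - N))..(τ k), Er m t ≤ cumEnergyConst ε₀ C₃ * (1 + ε₀) ^ ((747 : ℝ) / 100 * k) := by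
  have := h.integral_past_le hε₀ hC₃ (h.continuousOn_E m le_rfl) (D := 2 ^ 11)
    (s := (747 : ℝ) / 100) (by norm_num) (by norm_num) (fun k hk hk0 t ht => by
      have hb := h.energy_past_le hε₀ hε₀1 hK hm hk hk0 ht
      convert hb using 3; norm_num) hk1 hk2
  unfold cumEnergyConst
  linarith

/-- Lemma 6.7 at the present time: `∫_{τ_{n₀-N}}^0 Ẽ_m ≤ cumEnergyConst ε₀ C₃` for
`m ∈ {-1, 0, 1}`. [cite: Tao2016AveragedNS, §6.4 Lemma 6.7] -/
theorem RescaledSplitHypotheses.integral_energy_past_le_zero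
    (h : RescaledSplitHypotheses γ ε₀ K ε C₁ C₂ C₃ n₀ N ηp βp τ Xr W Er) (hε₀ : 0 < ε₀) (hε₀1 : ε₀ < 1)
    (hK : 1 ≤ K) (hC₃ : 0 ≤ C₃) (hN : n₀ ≤ N) {m : ℤ} (hm : m = -1 ∨ m = 0 ∨ m = 1) :
    ∫ t in (τ (n₀ - N))..0, Er m t ≤ cumEnergyConst ε₀ C₃ := by
  have := h.integral_energy_past_le hε₀ hε₀1 hK hC₃ hm (k := 0) (by omega) le_rfl
  simpa [h.tau_zero] using this

/-- The refined cumulative bound for `Ẽ_1`: `∫_{τ_{n₀-N}}^{τ_k} Ẽ_1 ≤ K^{-30} C₃ geomConst ·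
(1+ε₀)^{(747/100)k}` (used in Prop. 6.13). [cite: Tao2016AveragedNS, §6.6 Prop. 6.13] -/
theorem RescaledSplitHypotheses.integral_energy_one_past_le
    (h : RescaledSplitHypotheses γ ε₀ K ε C₁ C₂ C₃ n₀ N ηp βp τ Xr W Er) (hε₀ : 0 < ε₀) (hK : 0 < K)
    (hC₃ : 0 ≤ C₃) {k : ℤ} (hk1 : n₀ - N ≤ k) (hk2 : k ≤ 0) :
    ∫ t in (τ (n₀ - N))..(τ k), Er 1 t ≤
      (K ^ 30)⁻¹ * C₃ * geomConst ε₀ ((747 : ℝ) / 100) * (1 + ε₀) ^ ((747 : ℝ) / 100 * k) :=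
  h.integral_past_le hε₀ hC₃ (h.continuousOn_E 1 le_rfl) (by positivity) (by norm_num)
    (fun k hk hk0 t ht => by
      have hb := h.energy_one_past_le hε₀ hk hk0 ht
      convert hb using 3; norm_num) hk1 hk2

end Basic

section Bootstrap

variable {γ ε₀ K ε C₁ C₂ C₃ : ℝ} {n₀ N : ℤ} {ηp : ℤ → ℝ} {βp : ℕ → ℝ} {τ : ℤ → ℝ}
  {Xr : Fin 4 → ℤ → ℝ → ℝ} {W : Fin 3 → ℤ → ℝ → ℝ} {Er : ℤ → ℝ → ℝ}

/-! ## Lemma 6.8: initial bounds at the rescaled time `0` -/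

/-- **Lemma 6.8, (6.80)**: `Ẽ_{1-m}(0) ≤ (1+ε₀)^{-0.08} K^{-10} (1+ε₀)^{m/10}` for `m ≥ 2`
(for `m ≥ 3` from (ix) at `k = 0`, shifting `m` by one; for `m = 2` from `Ẽ_{-1}(0) ≤ K^{-20}`;
when `N = n₀` the energies below scale `0` vanish). [cite: Tao2016AveragedNS, §6.5 Lemma 6.8] -/
theorem RescaledSplitHypotheses.energy_zero_before
    (h : RescaledSplitHypotheses γ ε₀ K ε C₁ C₂ C₃ n₀ N ηp βp τ Xr W Er) (hε₀ : 0 < ε₀) (hK : 1 ≤ K)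
    (hN : n₀ ≤ N) (m : ℕ) (hm : 2 ≤ m) :
    Er (1 - m) 0 ≤ (1 + ε₀) ^ (-(2 : ℝ) / 25) * ((K ^ 10)⁻¹ * (1 + ε₀) ^ ((m : ℝ) / 10)) := by
  have h0 : (0 : ℝ) < 1 + ε₀ := by linarith
  have h1 : (1 : ℝ) ≤ 1 + ε₀ := by linarith
  have hK0 : 0 < K := by linarith
  rcases Nat.lt_or_ge m 3 with hm3 | hm3
  · -- m = 2
    obtain rfl : m = 2 := by omega
    have hst := h.energy_prev_le
    have hidx : (1 : ℤ) - ((2 : ℕ) : ℤ) = -1 := by norm_num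
    rw [hidx]
    have hq : (1 : ℝ) ≤ (1 + ε₀) ^ (-(2 : ℝ) / 25) * (1 + ε₀) ^ ((((2 : ℕ) : ℝ)) / 10) := by
      rw [← Real.rpow_add h0]
      exact Real.one_le_rpow h1 (by norm_num)
    have hK20 : (K ^ 20)⁻¹ ≤ (K ^ 10)⁻¹ := by
      apply inv_anti₀ (by positivity)
      exact pow_le_pow_right₀ hK (by norm_num)
    calc Er (-1) 0 ≤ (K ^ 20)⁻¹ := hst
      _ ≤ (K ^ 10)⁻¹ * 1 := by rw [mul_one]; exact hK20
      _ ≤ (K ^ 10)⁻¹ * ((1 + ε₀) ^ (-(2 : ℝ) / 25) * (1 + ε₀) ^ ((((2 : ℕ) : ℝ)) / 10)) :=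
          mul_le_mul_of_nonneg_left hq (by positivity)
      _ = _ := by ring
  · rcases eq_or_lt_of_le hN with hNn | hNn
    · -- N = n₀: no energy below scale 0
      have hz : Er (1 - m) 0 = 0 :=
        h.noLow_F _ _ (by omega) (by rw [← hNn, sub_self, h.tau_zero])
      rw [hz]; positivity
    · have hk : n₀ - N < 0 := by omega
      have ht : (0 : ℝ) ∈ Icc (τ (0 - 1)) (τ 0) := by
        rw [h.tau_zero]; exact ⟨h.tau_le _ (by omega) (by norm_num), le_rfl⟩
      have hb := h.en_before' 0 hk le_rfl 0 ht (m - 1) (by omega)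
      have hidx : (0 : ℤ) - ((m - 1 : ℕ) : ℤ) = 1 - m := by
        rw [Nat.cast_sub (by omega)]; push_cast; ring
      rw [hidx] at hb
      have hexp : (((m - 1 : ℕ) : ℝ)) / 10 + (1 - ((0 : ℤ) : ℝ)) / 50 =
          -(2 : ℝ) / 25 + (m : ℝ) / 10 := by
        rw [Nat.cast_sub (by omega)]; push_cast; ring
      rw [hexp, Real.rpow_add h0] at hb
      linarith

/-- **Lemma 6.8, (6.82)**: `Ẽ_{1+m}(0) ≤ (1+ε₀)^{-9.98} K^{-30} (1+ε₀)^{-10m}` for `m ≥ 1`.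
[cite: Tao2016AveragedNS, §6.5 Lemma 6.8] -/
theorem RescaledSplitHypotheses.energy_zero_after
    (h : RescaledSplitHypotheses γ ε₀ K ε C₁ C₂ C₃ n₀ N ηp βp τ Xr W Er) (hε₀ : 0 < ε₀) (hK : 0 < K)
    (hN : n₀ ≤ N) (m : ℕ) (hm : 1 ≤ m) :
    Er (1 + m) 0 ≤ (1 + ε₀) ^ (-(499 : ℝ) / 50) * ((K ^ 30)⁻¹ * (1 + ε₀) ^ (-(10 : ℝ) * m)) := by
  have h0 : (0 : ℝ) < 1 + ε₀ := by linarith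
  rcases eq_or_lt_of_le hN with hNn | hNn
  · have hz : Er (1 + m) 0 = 0 := by
      have := h.init_F (1 + m) (by omega)
      rwa [← hNn, sub_self, h.tau_zero] at this
    rw [hz]; positivity
  · have hk : n₀ - N < 0 := by omega
    have ht : (0 : ℝ) ∈ Icc (τ (0 - 1)) (τ 0) := by
      rw [h.tau_zero]; exact ⟨h.tau_le _ (by omega) (by norm_num), le_rfl⟩
    have hb := h.en_after' 0 hk le_rfl 0 ht (m + 1) (by omega)
    have hidx : (0 : ℤ) + ((m + 1 : ℕ) : ℤ) = 1 + m := by push_cast; ring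
    rw [hidx] at hb
    have hexp : -(10 : ℝ) * ((m + 1 : ℕ) : ℝ) + (1 - ((0 : ℤ) : ℝ)) / 50 =
        -(499 : ℝ) / 50 + -(10 : ℝ) * m := by push_cast; ring
    rw [hexp, Real.rpow_add h0] at hb
    linarith

/-- **Lemma 6.8, (6.83) for the energy**: `Ẽ_1(0) ≤ K^{-30}`.
[cite: Tao2016AveragedNS, §6.5 Lemma 6.8] -/
theorem RescaledSplitHypotheses.energy_one_zero_le
    (h : RescaledSplitHypotheses γ ε₀ K ε C₁ C₂ C₃ n₀ N ηp βp τ Xr W Er) (hε₀ : 0 < ε₀) (hK : 0 < K)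
    (hN : n₀ ≤ N) : Er 1 0 ≤ (K ^ 30)⁻¹ := by
  have h0 : (0 : ℝ) < 1 + ε₀ := by linarith
  have h1 : (1 : ℝ) ≤ 1 + ε₀ := by linarith
  rcases eq_or_lt_of_le hN with hNn | hNn
  · have hz : Er 1 0 = 0 := by
      have := h.init_F 1 (by omega)
      rwa [← hNn, sub_self, h.tau_zero] at this
    rw [hz]; positivity
  · have hk : n₀ - N < 0 := by omega
    have ht : (0 : ℝ) ∈ Icc (τ (0 - 1)) (τ 0) := by
      rw [h.tau_zero]; exact ⟨h.tau_le _ (by omega) (by norm_num), le_rfl⟩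
    have hb := h.en_after' 0 hk le_rfl 0 ht 1 le_rfl
    have hidx : (0 : ℤ) + ((1 : ℕ) : ℤ) = 1 := by norm_num
    rw [hidx] at hb
    have hle : (1 + ε₀) ^ (-(10 : ℝ) * ((1 : ℕ) : ℝ) + (1 - ((0 : ℤ) : ℝ)) / 50) ≤ 1 :=
      Real.rpow_le_one_of_one_le_of_nonpos h1 (by norm_num)
    calc Er 1 0 ≤ (K ^ 30)⁻¹ * (1 + ε₀) ^ (-(10 : ℝ) * ((1 : ℕ) : ℝ) + (1 - ((0 : ℤ) : ℝ)) / 50) := hb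
      _ ≤ (K ^ 30)⁻¹ * 1 := mul_le_mul_of_nonneg_left hle (by positivity)
      _ = _ := mul_one _

/-- **Lemma 6.8, (6.83)**: `|d_1(0)| ≤ √2 K^{-15}`. [cite: Tao2016AveragedNS, §6.5 Lemma 6.8] -/
theorem RescaledSplitHypotheses.abs_d_one_zero_le
    (h : RescaledSplitHypotheses γ ε₀ K ε C₁ C₂ C₃ n₀ N ηp βp τ Xr W Er) (hε₀ : 0 < ε₀) (hK : 0 < K)
    (hN : n₀ ≤ N) : |Xr 3 1 0| ≤ Real.sqrt 2 * (K ^ 15)⁻¹ := by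
  apply h.abs_le_of_energy_le 3 1 (h.tau_init_le hN) (by positivity)
  rw [mul_pow, Real.sq_sqrt (by norm_num : (0 : ℝ) ≤ 2)]
  have := h.energy_one_zero_le hε₀ hK hN
  have hK30 : ((K ^ 15)⁻¹) ^ 2 = (K ^ 30)⁻¹ := by rw [inv_pow, ← pow_mul]
  rw [hK30]
  linarith

/-- **Lemma 6.8, (6.81♯)**: `Ẽ_0(0) + Ẽ_1(0) ≤ 0.6`, for `γ ≤ 10⁻⁵`, `K ≥ 2`, `ε ≤ 1`, `n₀` so large that
`C₂ (1+ε₀)^{-n₀/2} · cumEnergyConst ε₀ C₃ ≤ 1/100`, and the checkpoint profile of the active shell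
`η(0) ≤ 10⁻³` (the energy defect (6.51♯) at the checkpoint carries `½ΣZ̃_0(0)² ≤ (3/2)η(0)²` — the one
place of Lemma 6.8 where the asymmetry enters). [cite: Tao2016AveragedNS, §6.5 Lemma 6.8] -/
theorem RescaledSplitHypotheses.energy_zero_during
    (h : RescaledSplitHypotheses γ ε₀ K ε C₁ C₂ C₃ n₀ N ηp βp τ Xr W Er) (hε₀ : 0 < ε₀) (hε₀1 : ε₀ < 1)
    (hγ1 : γ ≤ 1 / 10 ^ 5) (hK : 2 ≤ K) (hε : 0 < ε) (hε1 : ε ≤ 1) (hC₂ : 0 ≤ C₂)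
    (hC₃ : 0 ≤ C₃) (hN : n₀ ≤ N)
    (hn : C₂ * (1 + ε₀) ^ (-(n₀ : ℝ) / 2) * cumEnergyConst ε₀ C₃ ≤ 1 / 100)
    (hη0 : ηp 0 ≤ 1 / 10 ^ 3) :
    Er 0 0 + Er 1 0 ≤ 3 / 5 := by
  have h0 : (0 : ℝ) < 1 + ε₀ := by linarith
  have hK0 : 0 < K := by linarith
  have hK1 : 1 ≤ K := by linarith
  have hE1 := h.energy_one_zero_le hε₀ hK0 hN
  have hK30 : (K ^ 30)⁻¹ ≤ 1 / 100 := by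
    rw [inv_le_comm₀ (by positivity) (by norm_num)]
    calc ((1 : ℝ) / 100)⁻¹ = 100 := by norm_num
      _ ≤ 2 ^ 30 := by norm_num
      _ ≤ K ^ 30 := pow_le_pow_left₀ (by norm_num) hK 30
  -- the defect bound at `k = 0`, `t = 0`
  have hdef := h.defect_upper 0 0 (h.tau_init_le hN)
  have hcoef : C₂ * (1 + ε₀) ^ ((2 : ℝ) * ((0 : ℤ) : ℝ) - n₀ / 2) = C₂ * (1 + ε₀) ^ (-(n₀ : ℝ) / 2) := by
    congr 2; push_cast; ring
  rw [hcoef] at hdef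
  have hint := h.integral_energy_past_le_zero hε₀ hε₀1 hK1 hC₃ hN (m := 0) (by norm_num)
  have hint' : C₂ * (1 + ε₀) ^ (-(n₀ : ℝ) / 2) * ∫ s in (τ (n₀ - N))..0, Er 0 s ≤ 1 / 100 :=
    (mul_le_mul_of_nonneg_left hint (by positivity)).trans hn
  -- the sum of squares at time 0
  have ha : Xr 0 0 0 = 1 := h.a_eq
  have hb : |Xr 1 0 0| ≤ 1 / 10 ^ 5 := h.b_abs_le.trans (by nlinarith)
  have hc : |Xr 2 0 0| ≤ 1 / 10 ^ 5 := by
    refine h.c_abs_le.trans ?_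
    calc γ * ε ^ 2 ≤ 1 / 10 ^ 5 * 1 := mul_le_mul hγ1 (by nlinarith) (by positivity) (by norm_num)
      _ = 1 / 10 ^ 5 := by ring
  have hd : |Xr 3 0 0| ≤ 1 / 2 ^ 10 := by
    refine h.d_abs_le.trans ?_
    rw [one_div]
    exact inv_anti₀ (by positivity) (pow_le_pow_left₀ (by norm_num) hK 10)
  have hsq : ∀ {x c : ℝ}, |x| ≤ c → x ^ 2 ≤ c ^ 2 := fun hx =>
    (sq_abs _).symm.le.trans_eq' rfl |>.trans (pow_le_pow_left₀ (abs_nonneg _) hx 2) |> fun h => by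
      rw [← sq_abs]; exact pow_le_pow_left₀ (abs_nonneg _) hx 2
  have hsum : (1 / 2 : ℝ) * ∑ i, Xr i 0 0 ^ 2 ≤ 1 / 2 + 1 / 10 ^ 6 := by
    rw [Fin.sum_univ_four, ha]
    have := hsq hb; have := hsq hc; have := hsq hd
    nlinarith
  -- the asymmetry of the active shell at the checkpoint (profile clause)
  have hW : ∀ i : Fin 3, |W i 0 0| ≤ 1 / 10 ^ 3 := fun i => by
    have := h.w_abs_le i 0
    simp only [Nat.cast_zero] at this
    exact this.trans hη0
  have hsumW : (1 / 2 : ℝ) * ∑ i, W i 0 0 ^ 2 ≤ 3 / 2 * (1 / 10 ^ 3) ^ 2 := by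
    rw [Fin.sum_univ_three]
    have := hsq (hW 0); have := hsq (hW 1); have := hsq (hW 2)
    nlinarith
  have hsplit : (1 / 2 : ℝ) * (∑ i, Xr i 0 0 ^ 2 + ∑ i, W i 0 0 ^ 2) =
      (1 / 2 : ℝ) * ∑ i, Xr i 0 0 ^ 2 + (1 / 2 : ℝ) * ∑ i, W i 0 0 ^ 2 := by ring
  rw [hsplit] at hdef
  nlinarith

/-! ## The bootstrap regime `GoodAt` and the time `T₁` (§6.5) -/

/-- **`GoodAt` holds at time `0`** (this is how Lemma 6.8 "ensures that `T₁` is well-defined"),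
for `K ≥ 2`, `ε ≤ 1`, `n₀` large and `η(0) ≤ 10⁻³`. [cite: Tao2016AveragedNS, §6.5 Lemma 6.8] -/
theorem RescaledSplitHypotheses.goodAt_zero
    (h : RescaledSplitHypotheses γ ε₀ K ε C₁ C₂ C₃ n₀ N ηp βp τ Xr W Er) (hε₀ : 0 < ε₀) (hε₀1 : ε₀ < 1)
    (hγ1 : γ ≤ 1 / 10 ^ 5) (hK : 2 ≤ K) (hε : 0 < ε) (hε1 : ε ≤ 1) (hC₂ : 0 ≤ C₂) (hC₃ : 0 ≤ C₃)
    (hN : n₀ ≤ N) (hn : C₂ * (1 + ε₀) ^ (-(n₀ : ℝ) / 2) * cumEnergyConst ε₀ C₃ ≤ 1 / 100)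
    (hη0 : ηp 0 ≤ 1 / 10 ^ 3) :
    GoodAt ε₀ K Xr Er 0 := by
  have h0 : (0 : ℝ) < 1 + ε₀ := by linarith
  have h1 : (1 : ℝ) ≤ 1 + ε₀ := by linarith
  have hK0 : 0 < K := by linarith
  have hK1 : 1 ≤ K := by linarith
  refine ⟨fun m hm => ?_, ?_, fun m hm => ?_, ?_⟩
  · have hb := h.energy_zero_before hε₀ hK1 hN m hm
    have hle : (1 + ε₀) ^ (-(2 : ℝ) / 25) ≤ 1 := Real.rpow_le_one_of_one_le_of_nonpos h1 (by norm_num)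
    have hpos : 0 ≤ (K ^ 10)⁻¹ * (1 + ε₀) ^ ((m : ℝ) / 10) := by positivity
    nlinarith
  · linarith [h.energy_zero_during hε₀ hε₀1 hγ1 hK hε hε1 hC₂ hC₃ hN hn hη0]
  · have hb := h.energy_zero_after hε₀ hK0 hN m hm
    have hle : (1 + ε₀) ^ (-(499 : ℝ) / 50) ≤ 1 :=
      Real.rpow_le_one_of_one_le_of_nonpos h1 (by norm_num)
    have hpos : 0 ≤ (K ^ 30)⁻¹ * (1 + ε₀) ^ (-(10 : ℝ) * m) := by positivity
    nlinarith
  · have hd := h.abs_d_one_zero_le hε₀ hK0 hN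
    refine hd.trans ?_
    -- `√2 K^{-15} ≤ ½ K^{-10}` iff `2√2 ≤ K^5`
    have hs : Real.sqrt 2 ≤ 2 := by
      rw [Real.sqrt_le_left (by norm_num)]; norm_num
    have hK5 : (4 : ℝ) ≤ K ^ 5 := le_trans (by norm_num) (pow_le_pow_left₀ (by norm_num) hK 5)
    rw [show (K ^ 15)⁻¹ = (K ^ 5)⁻¹ * (K ^ 10)⁻¹ by rw [← mul_inv, ← pow_add]]
    have hK5i : (K ^ 5)⁻¹ ≤ 1 / 4 := by
      rw [one_div]; exact inv_anti₀ (by norm_num) hK5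
    have hK10 : 0 < (K ^ 10)⁻¹ := by positivity
    calc Real.sqrt 2 * ((K ^ 5)⁻¹ * (K ^ 10)⁻¹) = (Real.sqrt 2 * (K ^ 5)⁻¹) * (K ^ 10)⁻¹ := by ring
      _ ≤ 1 / 2 * (K ^ 10)⁻¹ := by
          apply mul_le_mul_of_nonneg_right _ hK10.le
          have : 0 ≤ (K ^ 5)⁻¹ := by positivity
          nlinarith

/-- **`GoodAt` is closed under limits from the left** ("all the conditions here are closed
conditions in `t`", p. 35). [cite: Tao2016AveragedNS, §6.5 p. 35] -/
theorem RescaledSplitHypotheses.goodAt_of_Ico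
    (h : RescaledSplitHypotheses γ ε₀ K ε C₁ C₂ C₃ n₀ N ηp βp τ Xr W Er) (hN : n₀ ≤ N) {t : ℝ} (ht : 0 < t)
    (hgood : ∀ s ∈ Ico 0 t, GoodAt ε₀ K Xr Er s) : GoodAt ε₀ K Xr Er t := by
  have hτ := h.tau_init_le hN
  refine ⟨fun m hm => ?_, ?_, fun m hm => ?_, ?_⟩
  · exact le_of_Ico_of_continuousOn ht (h.continuousOn_E _ hτ) fun s hs => (hgood s hs).before m hm
  · exact le_of_Ico_of_continuousOn (F := fun s => Er 0 s + Er 1 s) ht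
      ((h.continuousOn_E 0 hτ).add (h.continuousOn_E 1 hτ)) fun s hs => (hgood s hs).during
  · exact le_of_Ico_of_continuousOn ht (h.continuousOn_E _ hτ) fun s hs => (hgood s hs).after m hm
  · exact le_of_Ico_of_continuousOn (F := fun s => |Xr 3 1 s|) ht ((h.continuousOn_X 3 1 hτ).abs)
      fun s hs => (hgood s hs).d_le

/-- **`GoodAt` holds on `[0, T₁]`.** [cite: Tao2016AveragedNS, §6.5 p. 35] -/
theorem RescaledSplitHypotheses.goodAt_of_mem_T1
    (h : RescaledSplitHypotheses γ ε₀ K ε C₁ C₂ C₃ n₀ N ηp βp τ Xr W Er) (hN : n₀ ≤ N)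
    (h0 : GoodAt ε₀ K Xr Er 0) {t : ℝ} (ht : t ∈ Icc 0 (T1 ε₀ K Xr Er)) : GoodAt ε₀ K Xr Er t :=
  maximalTimeP_spec (by norm_num) h0 (fun _ ht' hgood => h.goodAt_of_Ico hN ht'.1 hgood) ht

/-- **Finitely many conditions** (Tao, p. 35: "The bounds … look like an infinite number of
conditions, but note from the qualitative decay property (6.42) that … (6.84), (6.86) are
automatically satisfied for all `m ≥ M` and some finite `M` … As `Ẽ_m` and `d_1` vary continuously
in time …"): if at a time `T ∈ [0, 100]` every condition of `GoodAt` holds *strictly*, then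
`GoodAt` holds at all times of `[0, 100]` near `T`. [cite: Tao2016AveragedNS, §6.5 p. 35] -/
theorem RescaledSplitHypotheses.eventually_goodAt_of_strict
    (h : RescaledSplitHypotheses γ ε₀ K ε C₁ C₂ C₃ n₀ N ηp βp τ Xr W Er) (hε₀ : 0 < ε₀) (hK : 0 < K)
    (hN : n₀ ≤ N) {T : ℝ} (hT : T ∈ Icc 0 100)
    (h1 : ∀ m : ℕ, 2 ≤ m → Er (1 - m) T < (K ^ 10)⁻¹ * (1 + ε₀) ^ ((m : ℝ) / 10))
    (h2 : Er 0 T + Er 1 T < 1)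
    (h3 : ∀ m : ℕ, 1 ≤ m → Er (1 + m) T < (K ^ 30)⁻¹ * (1 + ε₀) ^ (-(10 : ℝ) * m))
    (h4 : |Xr 3 1 T| < 1 / 2 * (K ^ 10)⁻¹) :
    ∀ᶠ t in 𝓝[Icc 0 100] T, GoodAt ε₀ K Xr Er t := by
  have hq0 : (0 : ℝ) < 1 + ε₀ := by linarith
  have hq1 : (1 : ℝ) < 1 + ε₀ := by linarith
  have hτ := h.tau_init_le hN
  -- a priori bound on `[τ₀, 100]`
  obtain ⟨M, hM⟩ := h.apriori_F 100 (by linarith)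
  have hM' : ∀ t ∈ Icc (0 : ℝ) 100, ∀ k : ℤ,
      Er k t ≤ M ^ 2 ∧ Er k t ≤ M ^ 2 * (1 + ε₀) ^ (-(20 : ℝ) * k) := by
    intro t ht k
    have ht' : t ∈ Icc (τ (n₀ - N)) 100 := ⟨hτ.trans ht.1, ht.2⟩
    have hb := hM t ht' k
    have hE0 : 0 ≤ Er k t := h.nonneg_F k t ht'.1
    have hs0 : 0 ≤ Real.sqrt (Er k t) := Real.sqrt_nonneg _
    have hP : 0 < (1 + ε₀) ^ ((10 : ℝ) * k) := Real.rpow_pos_of_pos hq0 _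
    have hsq : Real.sqrt (Er k t) ≤ M := by nlinarith
    have hM0 : 0 ≤ M := hs0.trans hsq
    have hsq' : (1 + ε₀) ^ ((10 : ℝ) * k) * Real.sqrt (Er k t) ≤ M := by nlinarith
    constructor
    · calc Er k t = Real.sqrt (Er k t) ^ 2 := (Real.sq_sqrt hE0).symm
        _ ≤ M ^ 2 := pow_le_pow_left₀ hs0 hsq 2
    · have hPsq : ((1 + ε₀) ^ ((10 : ℝ) * k)) ^ 2 * (1 + ε₀) ^ (-(20 : ℝ) * k) = 1 := by
        rw [sq, ← Real.rpow_add hq0, ← Real.rpow_add hq0]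
        convert Real.rpow_zero (1 + ε₀) using 2; ring
      calc Er k t = ((1 + ε₀) ^ ((10 : ℝ) * k) * Real.sqrt (Er k t)) ^ 2 *
            (1 + ε₀) ^ (-(20 : ℝ) * k) := by
            rw [mul_pow, Real.sq_sqrt hE0]
            rw [mul_comm (((1 + ε₀) ^ ((10 : ℝ) * k)) ^ 2), mul_assoc, hPsq, mul_one]
        _ ≤ M ^ 2 * (1 + ε₀) ^ (-(20 : ℝ) * k) := by
            apply mul_le_mul_of_nonneg_right _ (Real.rpow_pos_of_pos hq0 _).le
            exact pow_le_pow_left₀ (by positivity) hsq' 2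
  -- thresholds beyond which the conditions are automatic
  obtain ⟨m₁, hm₁⟩ := pow_unbounded_of_one_lt (M ^ 2 * K ^ 10)
    (Real.one_lt_rpow hq1 (by norm_num : (0 : ℝ) < 1 / 10))
  obtain ⟨m₃, hm₃⟩ := pow_unbounded_of_one_lt (M ^ 2 * K ^ 30)
    (Real.one_lt_rpow hq1 (by norm_num : (0 : ℝ) < 10))
  have hauto1 : ∀ t ∈ Icc (0 : ℝ) 100, ∀ m : ℕ, m₁ ≤ m →
      Er (1 - m) t ≤ (K ^ 10)⁻¹ * (1 + ε₀) ^ ((m : ℝ) / 10) := by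
    intro t ht m hm
    have hE := (hM' t ht (1 - m)).1
    have hpow : ((1 + ε₀) ^ ((1 : ℝ) / 10)) ^ m₁ ≤ (1 + ε₀) ^ ((m : ℝ) / 10) := by
      rw [← Real.rpow_natCast, ← Real.rpow_mul hq0.le]
      apply Real.rpow_le_rpow_of_exponent_le hq1.le
      have : (m₁ : ℝ) ≤ m := by exact_mod_cast hm
      linarith
    rw [le_inv_mul_iff₀ (by positivity)]
    calc K ^ 10 * Er (1 - m) t ≤ K ^ 10 * M ^ 2 := mul_le_mul_of_nonneg_left hE (by positivity)
      _ = M ^ 2 * K ^ 10 := by ring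
      _ ≤ ((1 + ε₀) ^ ((1 : ℝ) / 10)) ^ m₁ := hm₁.le
      _ ≤ _ := hpow
  have hauto3 : ∀ t ∈ Icc (0 : ℝ) 100, ∀ m : ℕ, m₃ ≤ m →
      Er (1 + m) t ≤ (K ^ 30)⁻¹ * (1 + ε₀) ^ (-(10 : ℝ) * m) := by
    intro t ht m hm
    have hE := (hM' t ht (1 + m)).2
    have hpow : ((1 + ε₀) ^ (10 : ℝ)) ^ m₃ ≤ (1 + ε₀) ^ ((10 : ℝ) * m) := by
      rw [← Real.rpow_natCast, ← Real.rpow_mul hq0.le]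
      apply Real.rpow_le_rpow_of_exponent_le hq1.le
      have : (m₃ : ℝ) ≤ m := by exact_mod_cast hm
      nlinarith
    rw [le_inv_mul_iff₀ (by positivity)]
    have hsplit : (1 + ε₀) ^ (-(20 : ℝ) * ((1 + m : ℤ) : ℝ)) =
        (1 + ε₀) ^ (-(10 : ℝ) * m) * ((1 + ε₀) ^ ((10 : ℝ) * m) * (1 + ε₀) ^ (20 : ℝ))⁻¹ := by
      rw [← Real.rpow_add hq0, ← Real.rpow_neg hq0.le, ← Real.rpow_add hq0]
      congr 1; push_cast; ring
    have h20 : (1 : ℝ) ≤ (1 + ε₀) ^ (20 : ℝ) := Real.one_le_rpow hq1.le (by norm_num)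
    have hP10 : 0 < (1 + ε₀) ^ ((10 : ℝ) * m) := Real.rpow_pos_of_pos hq0 _
    have hP10' : 0 < (1 + ε₀) ^ (-(10 : ℝ) * m) := Real.rpow_pos_of_pos hq0 _
    calc K ^ 30 * Er (1 + m) t ≤ K ^ 30 * (M ^ 2 * (1 + ε₀) ^ (-(20 : ℝ) * ((1 + m : ℤ) : ℝ))) := by
          have := hE; push_cast at this ⊢; exact mul_le_mul_of_nonneg_left this (by positivity)
      _ = (M ^ 2 * K ^ 30) * ((1 + ε₀) ^ ((10 : ℝ) * m) * (1 + ε₀) ^ (20 : ℝ))⁻¹ *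
            (1 + ε₀) ^ (-(10 : ℝ) * m) := by rw [hsplit]; ring
      _ ≤ ((1 + ε₀) ^ ((10 : ℝ) * m)) * ((1 + ε₀) ^ ((10 : ℝ) * m) * (1 + ε₀) ^ (20 : ℝ))⁻¹ *
            (1 + ε₀) ^ (-(10 : ℝ) * m) := by
          apply mul_le_mul_of_nonneg_right _ hP10'.le
          apply mul_le_mul_of_nonneg_right (hm₃.le.trans hpow) (by positivity)
      _ ≤ 1 * (1 + ε₀) ^ (-(10 : ℝ) * m) := by
          apply mul_le_mul_of_nonneg_right _ hP10'.le
          rw [mul_inv, ← mul_assoc, mul_inv_cancel₀ hP10.ne', one_mul]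
          exact inv_le_one_of_one_le₀ h20
      _ = _ := one_mul _
  -- continuity of the finitely many remaining conditions
  have hcontE : ∀ k : ℤ, ContinuousWithinAt (Er k) (Icc 0 100) T := fun k =>
    (h.continuousOn_E k hτ).continuousWithinAt hT |>.mono fun x hx => hx
  have hcontD : ContinuousWithinAt (fun t => |Xr 3 1 t|) (Icc 0 100) T :=
    ((h.continuousOn_X 3 1 hτ).abs).continuousWithinAt hT
  have hev1 : ∀ᶠ t in 𝓝[Icc 0 100] T, ∀ m ∈ Finset.range m₁, 2 ≤ m →
      Er (1 - m) t < (K ^ 10)⁻¹ * (1 + ε₀) ^ ((m : ℝ) / 10) := by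
    rw [eventually_all_finset]
    intro m _
    by_cases hm : 2 ≤ m
    · exact ((hcontE (1 - m)).eventually_lt_const (h1 m hm)).mono fun t ht _ => ht
    · exact Eventually.of_forall fun t hm' => absurd hm' hm
  have hev2 : ∀ᶠ t in 𝓝[Icc 0 100] T, Er 0 t + Er 1 t < 1 :=
    ((hcontE 0).add (hcontE 1)).eventually_lt_const h2
  have hev3 : ∀ᶠ t in 𝓝[Icc 0 100] T, ∀ m ∈ Finset.range m₃, 1 ≤ m →
      Er (1 + m) t < (K ^ 30)⁻¹ * (1 + ε₀) ^ (-(10 : ℝ) * m) := by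
    rw [eventually_all_finset]
    intro m _
    by_cases hm : 1 ≤ m
    · exact ((hcontE (1 + m)).eventually_lt_const (h3 m hm)).mono fun t ht _ => ht
    · exact Eventually.of_forall fun t hm' => absurd hm' hm
  have hev4 : ∀ᶠ t in 𝓝[Icc 0 100] T, |Xr 3 1 t| < 1 / 2 * (K ^ 10)⁻¹ :=
    hcontD.eventually_lt_const h4
  have hmem : ∀ᶠ t in 𝓝[Icc 0 100] T, t ∈ Icc (0 : ℝ) 100 := eventually_mem_nhdsWithin
  filter_upwards [hev1, hev2, hev3, hev4, hmem] with t ht1 ht2 ht3 ht4 htm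
  refine ⟨fun m hm => ?_, ht2.le, fun m hm => ?_, ht4.le⟩
  · by_cases hmm : m < m₁
    · exact (ht1 m (Finset.mem_range.mpr hmm) hm).le
    · exact hauto1 t htm m (not_lt.mp hmm)
  · by_cases hmm : m < m₃
    · exact (ht3 m (Finset.mem_range.mpr hmm) hm).le
    · exact hauto3 t htm m (not_lt.mp hmm)

end Bootstrap

end Tao2016AveragedNS

end Literature.Analysis.FluidPDE
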